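import Literature.AlgebraicGeometry.Resolution.BlowupSequencesComapMarked
import Literature.AlgebraicGeometry.Resolution.BlowupSequencesExtensions
import Literature.AlgebraicGeometry.Resolution.SpreadIdealSheafInclusion
import Literature.AlgebraicGeometry.Resolution.SmoothGenericFibreSpread
import Mathlib.RingTheory.Localization.BaseChange
import HarnessLib

/-!
# Spreading out a multiple blow-up from the generic fibre: the model tower over the base

Topic: `Literature/AlgebraicGeometry/Resolution`. First step of the spreading-out argument for
`SpreadsShapedFromGenericPoint` (`CanonicalResolutionSpread.lean`; EGA IV₃ §8 technique): a
multiple blow-up `s_K` (`CentreSeq`, `BlowupSequences.lean`) of the generic fibre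
`X_K = X ×_{Spec A} Spec K` of a scheme `q : X → Spec A` over a domain `A` with fraction field `K`
is induced (`CentreSeq.comap`, `CentreSeq.IsPullbackAlong`) from a multiple blow-up of `X`
itself — WITHOUT shrinking the base. PROVED:

* `isLocalization_app_of_isPullback_generic` — over an affine open `U = Spec B` of `X`, the
  sections `Γ(X_K, jK⁻¹U)` form the localization of `B` at the image of `A ∖ 0` (the chart
  `Spec (B ⊗_A K)`, `specTensorChart`);
* `comap_map_eq_of_isPullback_generic` — **every ideal sheaf of the generic fibre is the
  pull-back of its push-forward**: `jK^*(jK_* 𝓘) = 𝓘` (Mathlib's `IdealSheafData.map`/`comap`;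
  on the chart, extension of the contraction of an ideal along a localization is the ideal,
  `IsLocalization.map_comap`);
* `CentreSeq.exists_isPullbackAlong_of_isPullback_generic` — **every multiple blow-up of `X_K`
  is induced from a multiple blow-up of `X`**: spread the first centre by push-forward, blow it
  up on `X`, observe that the blow-up of `X` has generic fibre the blow-up of `X_K` (blow-ups
  commute with the flat base change `jK`, `blowup.isPullback_comapMap`), and recurse;
  `CentreSeq.exists_comap_eq_of_isPullback_generic` (`s.comap jK = s_K`).

## Sources

* A. Grothendieck, J. Dieudonné, EGA IV₃ (Publ. Math. IHÉS 28, 1966), §8.6 (closed subschemes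
  of the generic fibre come from the model). [folklore]
* U. Görtz, T. Wedhorn, *Algebraic Geometry I*, 2nd ed. (2020), Prop. 13.91 (blow-ups and flat
  base change). [GortzWedhorn2020]
-/

noncomputable section

open CategoryTheory CategoryTheory.Limits AlgebraicGeometry TopologicalSpace TensorProduct

namespace Literature.AlgebraicGeometry.Resolution

universe u

open Scheme.IdealSheafData

section Generic

variable {A : Type u} [CommRing A] (K : Type u) [Field K] [Algebra A K]
  [IsFractionRing A K] {X XK : Scheme.{u}} (q : X ⟶ Spec (.of A)) {jK : XK ⟶ X}
  {qK : XK ⟶ Spec (.of K)} (HK : IsPullback jK qK q (specOfAlgebra A K))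

include HK in
/-- The inclusion of the generic fibre is flat. [folklore] -/
theorem flat_of_isPullback_generic : Flat jK :=
  MorphismProperty.of_isPullback HK.flip (flat_specMap_fractionRing (A := A) K)

omit [IsFractionRing A K] in
include HK in
/-- The inclusion of the generic fibre is an affine morphism. [folklore] -/
theorem isAffineHom_of_isPullback_generic : IsAffineHom jK :=
  MorphismProperty.of_isPullback HK.flip (inferInstance : IsAffineHom (specOfAlgebra A K))

include HK in
/-- **Over an affine open `U` of `X`, the sections of the generic fibre over `jK⁻¹U` form the
localization of `Γ(X, U)` at the non-zero elements of `A`** (for the algebra structures given by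
`q` and `jK`): the chart `Spec (Γ(X, U) ⊗_A K) ≅ jK⁻¹U`. [folklore] -/
theorem isLocalization_app_of_isPullback_generic (U : X.affineOpens) :
    haveI := isAffineHom_of_isPullback_generic K q HK
    letI : Algebra A Γ(X, U) := (Spec.preimage (U.2.fromSpec ≫ q)).hom.toAlgebra
    letI : Algebra Γ(X, U) Γ(XK, jK ⁻¹ᵁ U) := (jK.app U).hom.toAlgebra
    IsLocalization (Algebra.algebraMapSubmonoid Γ(X, U) (nonZeroDivisors A)) Γ(XK, jK ⁻¹ᵁ U) := by
  haveI := isAffineHom_of_isPullback_generic K q HK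
  letI algA : Algebra A Γ(X, U) := (Spec.preimage (U.2.fromSpec ≫ q)).hom.toAlgebra
  letI algU : Algebra Γ(X, U) Γ(XK, jK ⁻¹ᵁ U) := (jK.app U).hom.toAlgebra
  have hi : U.2.fromSpec ≫ q = Spec.map (CommRingCat.ofHom (algebraMap A Γ(X, U))) := by
    rw [RingHom.algebraMap_toAlgebra, CommRingCat.ofHom_hom, Spec.map_preimage]
  -- the chart `Spec (Γ(X, U) ⊗ K) → X ×_A Spec K ≅ X_K`
  let c₀ := specTensorChart K q U.2.fromSpec hi
  let e : XK ≅ pullback q (specOfAlgebra A K) := HK.isoPullback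
  let c : Spec (.of (Γ(X, U) ⊗[A] K)) ⟶ XK := c₀ ≫ e.inv
  haveI : IsOpenImmersion c := inferInstance
  have hcjK : c ≫ jK = Spec.map (CommRingCat.ofHom
      (Algebra.TensorProduct.includeLeftRingHom (R := A) (A := Γ(X, U)) (B := K))) ≫ U.2.fromSpec := by
    rw [Category.assoc, show e.inv ≫ jK = pullback.fst q (specOfAlgebra A K) from
      HK.isoPullback_inv_fst, specTensorChart_fst]
  -- its image is `jK⁻¹U`
  have hrange : c ''ᵁ ⊤ = jK ⁻¹ᵁ (U : X.Opens) := by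
    apply le_antisymm
    · rintro _ ⟨y, -, rfl⟩
      show (c ≫ jK) y ∈ (U : X.Opens)
      rw [hcjK, Scheme.Hom.comp_apply]
      exact U.2.range_fromSpec.le ⟨_, rfl⟩
    · intro x hx
      have hx' : e.hom x ∈ pullback.fst q (specOfAlgebra A K) ⁻¹ᵁ (U : X.Opens) := by
        show pullback.fst q (specOfAlgebra A K) (e.hom x) ∈ (U : X.Opens)
        rw [← Scheme.Hom.comp_apply, HK.isoPullback_hom_fst]
        exact hx
      rw [← image_top_specTensorChart K q U hi] at hx'
      obtain ⟨y, -, hy⟩ := hx'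
      refine ⟨y, trivial, ?_⟩
      have hy' : c₀ y = e.hom x := hy
      show (c₀ ≫ e.inv) y = x
      rw [Scheme.Hom.comp_apply, hy', ← Scheme.Hom.comp_apply, Iso.hom_inv_id]
      rfl
  -- sections: `Γ(X_K, jK⁻¹U) ≅ Γ(X, U) ⊗ K`, compatibly with the structure maps
  let ε : Γ(XK, jK ⁻¹ᵁ U) ≅ CommRingCat.of (Γ(X, U) ⊗[A] K) :=
    XK.presheaf.mapIso (eqToIso hrange).op ≪≫ c.appIso ⊤ ≪≫ Scheme.ΓSpecIso _
  have hε : ∀ b : Γ(X, U), ε.hom (algebraMap Γ(X, U) Γ(XK, jK ⁻¹ᵁ U) b) = b ⊗ₜ[A] (1 : K) := by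
    intro b
    have h1 : algebraMap Γ(X, U) Γ(XK, jK ⁻¹ᵁ U) b = jK.app U b := rfl
    have h2 : (XK.presheaf.mapIso (eqToIso hrange).op).hom (jK.app U b) =
        jK.appLE U (c ''ᵁ ⊤) hrange.le b := by
      rw [Functor.mapIso_hom, Scheme.Hom.app_eq_appLE, ← CommRingCat.comp_apply,
        Scheme.Hom.appLE_map]
    have h3 : (c.appIso ⊤).hom (jK.appLE U (c ''ᵁ ⊤) hrange.le b) =
        (Scheme.ΓSpecIso (.of (Γ(X, U) ⊗[A] K))).inv (b ⊗ₜ[A] (1 : K)) := by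
      rw [Scheme.Hom.appIso_hom', ← CommRingCat.comp_apply, Scheme.Hom.appLE_comp_appLE,
        appLE_top_of_eq_SpecMap_comp_fromSpec U _ _ hcjK, CommRingCat.comp_apply]
      rfl
    change (Scheme.ΓSpecIso _).hom ((c.appIso ⊤).hom
      ((XK.presheaf.mapIso (eqToIso hrange).op).hom (algebraMap Γ(X, U) Γ(XK, jK ⁻¹ᵁ U) b))) = _
    rw [h1, h2, h3, ← CommRingCat.comp_apply, Iso.inv_hom_id]
    rfl
  -- `Γ(X, U) ⊗ K` is the localization; transport along `ε`
  haveI : IsLocalization (Algebra.algebraMapSubmonoid Γ(X, U) (nonZeroDivisors A))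
      (Γ(X, U) ⊗[A] K) := inferInstance
  let εa : Γ(XK, jK ⁻¹ᵁ U) ≃ₐ[Γ(X, U)] Γ(X, U) ⊗[A] K :=
    { ε.commRingCatIsoToRingEquiv with
      commutes' := fun b => by
        change ε.hom (algebraMap Γ(X, U) Γ(XK, jK ⁻¹ᵁ U) b) = algebraMap Γ(X, U) (Γ(X, U) ⊗[A] K) b
        rw [hε]
        rfl }
  exact IsLocalization.isLocalization_of_algEquiv _ εa.symm

include HK in
/-- **Every ideal sheaf of the generic fibre is the pull-back of its push-forward**:
`jK^*(jK_* 𝓘) = 𝓘` for the inclusion `jK : X_K → X` of the generic fibre (`X_K = X ×_A Spec K`,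
any cartesian square). On the affine open `jK⁻¹U`, `U ⊆ X` affine, the push-forward has sections
the contraction of `𝓘(jK⁻¹U)` to `Γ(X, U)` and the pull-back re-extends it along the
localization `Γ(X, U) → Γ(X_K, jK⁻¹U)`; extension of contraction is the identity for
localizations. [folklore] -/
theorem comap_map_eq_of_isPullback_generic (I : XK.IdealSheafData) : (I.map jK).comap jK = I := by
  haveI := isAffineHom_of_isPullback_generic K q HK
  -- the affine opens `jK⁻¹U`, `U ⊆ X` affine, cover `X_K`
  refine ext_of_iSup_eq_top (fun U : X.affineOpens => ⟨jK ⁻¹ᵁ (U : X.Opens), U.2.preimage jK⟩)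
    ?_ fun U => ?_
  · rw [← Scheme.Hom.preimage_iSup, iSup_affineOpens_eq_top, Scheme.Hom.preimage_top]
  · letI : Algebra A Γ(X, U) := (Spec.preimage (U.2.fromSpec ≫ q)).hom.toAlgebra
    letI : Algebra Γ(X, U) Γ(XK, jK ⁻¹ᵁ U) := (jK.app U).hom.toAlgebra
    haveI := isLocalization_app_of_isPullback_generic K q HK U
    rw [ideal_comap_of_le jK (I.map jK) U ⟨jK ⁻¹ᵁ (U : X.Opens), U.2.preimage jK⟩ le_rfl,
      ideal_map_of_isAffineHom, ← Scheme.Hom.app_eq_appLE]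
    exact IsLocalization.map_under (Algebra.algebraMapSubmonoid Γ(X, U) (nonZeroDivisors A))
      Γ(XK, jK ⁻¹ᵁ U) _

end Generic

/-! ## The model tower -/

namespace CentreSeq

variable {A : Type u} [CommRing A] (K : Type u) [Field K] [Algebra A K] [IsFractionRing A K]

/-- **Every multiple blow-up of the generic fibre is induced from a multiple blow-up of the
model**: for `q : X → Spec A` with generic fibre `jK : X_K → X` (any cartesian square over
`Spec K → Spec A`) and `s_K` a multiple blow-up of `X_K`, there is a multiple blow-up `s` of `X`
with `s_K` induced from `s` along `jK` (`IsPullbackAlong`). The first centre is spread by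
push-forward (`comap_map_eq_of_isPullback_generic`); the chosen blow-up of `X` along it has
generic fibre the chosen blow-up of `X_K` (`blowup.isPullback_comapMap`, `jK` flat), to which
the construction is applied recursively. [folklore] -/
theorem exists_isPullbackAlong_of_isPullback_generic :
    ∀ {XK : Scheme.{u}} (sK : CentreSeq XK) {X : Scheme.{u}} (q : X ⟶ Spec (.of A))
      (jK : XK ⟶ X) (qK : XK ⟶ Spec (.of K)), IsPullback jK qK q (specOfAlgebra A K) →
      ∃ s : CentreSeq X, IsPullbackAlong jK s sK
  | _, nil _, X, _, _, _, _ => ⟨nil X, trivial⟩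
  | XK, cons CK restK, X, q, jK, qK, HK => by
    haveI : Flat jK := flat_of_isPullback_generic K q HK
    -- spread the first centre
    set C : X.IdealSheafData := CK.map jK with hCdef
    have hC : C.comap jK = CK := comap_map_eq_of_isPullback_generic K q HK CK
    -- the blow-up of `X` along `C` pulls back along the flat `jK` to a blow-up of `X_K` along `CK`
    have h1 : IsBlowup (pullback.snd (blowup.π C) jK) CK := by
      have h := (blowup.isBlowup C).pullback_snd_of_flat jK
      rwa [hC] at h
    obtain ⟨e, he, -⟩ := (blowup.isBlowup CK).unique h1
    set g : blowup CK ⟶ blowup C := e.hom ≫ pullback.fst (blowup.π C) jK with hgdef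
    have hg : g ≫ blowup.π C = blowup.π CK ≫ jK := by
      rw [hgdef, Category.assoc, pullback.condition, reassoc_of% he]
    have H1 : IsPullback g (blowup.π CK) (blowup.π C) jK := IsPullback.of_iso_pullback ⟨hg⟩ e rfl he
    obtain ⟨rest, hrest⟩ := exists_isPullbackAlong_of_isPullback_generic restK (blowup.π C ≫ q) g
      (blowup.π CK ≫ qK) (H1.paste_vert HK)
    exact ⟨cons C rest, hC.symm, g, hg, hrest⟩

/-- **Every multiple blow-up of the generic fibre is `s.comap jK` for a multiple blow-up `s` of
the model.** [folklore] -/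
theorem exists_comap_eq_of_isPullback_generic {XK X : Scheme.{u}} (sK : CentreSeq XK)
    (q : X ⟶ Spec (.of A)) (jK : XK ⟶ X) (qK : XK ⟶ Spec (.of K))
    (HK : IsPullback jK qK q (specOfAlgebra A K)) : ∃ s : CentreSeq X, s.comap jK = sK := by
  obtain ⟨s, hs⟩ := exists_isPullbackAlong_of_isPullback_generic K sK q jK qK HK
  exact ⟨s, hs.eq_comap.symm⟩

end CentreSeq

end Literature.AlgebraicGeometry.Resolution

end
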